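import Mathlib
import Summits.Ventures.PercRepro2.MixChordOSeparated

/-!
# The `o`-class chord whenever `o`, `a₃`, `b` are NOT ALL in one component of `G − {a₁, a₂}`
(blind cell PercRepro2, night-1 g23; proofs/NIGHT1-G23.md §7)

With the roots removed, the three other marks fall into components.  If `o` and `b` are in different
components, `Gc = 0` for every `a₃` (typer-1 g49's (SEP-2), `SepTwoGcZero.Gc_eq_zero_of_sepPair`) and every
chord is trivial (`dChord_of_Gc_eq_zero`).  If `o` and `b` share a component that does not contain `a₃`, the
separated-`a₃` theorem of MixChordOSeparated.lean applies.  Hence: **`dChord_o_edge_of_not_same_component`**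
/ **`dChord_o_edge₂_of_not_same_component`** — the `o`-class `D`-chord along both `o`-edges, and
**`HCov_of_not_same_component`**, whenever `¬ (b ∈ K_o ∧ a₃ ∈ K_o)` with `K_o` the component of `o`; the
chain's rows `dz2Chord_o_edge_of_not_same_component` / `_o_edge₂_`.  The `o`-row of the chain of record is
therefore open exactly on the instances in which `o`, `a₃`, `b` lie in ONE component of `G − {a₁, a₂}`.

Own code; standard axioms.
-/

namespace Summit.Ventures.PercRepro2

open UnionCluster CovForm SepTwoGcZero SepPair SepZero

namespace Mix

namespace Sep

open scoped Classical

section Trivial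

variable {V : Type*} {E : Type*} [Fintype E] [DecidableEq E] [DecidableEq V]
  {R : Type*} [Field R] [LinearOrder R] [IsStrictOrderedRing R]

variable (p : E → R) (ends : E → Sym2 V) (o a₁ a₂ a₃ b : V) (f : E)

omit [DecidableEq V] [IsStrictOrderedRing R] in
/-- A chord with any normaliser is trivial when `Gc` vanishes at `p` and at both pins of `f`. -/
lemma dChord_of_Gc_eq_zero (N : (E → R) → R) (h : Gc p ends o a₁ a₂ a₃ b = 0)
    (h0 : Gc (Function.update p f 0) ends o a₁ a₂ a₃ b = 0)
    (h1 : Gc (Function.update p f 1) ends o a₁ a₂ a₃ b = 0) :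
    NMixChord N p ends o a₁ a₂ a₃ b f := by
  unfold NMixChord
  rw [h, h0, h1]
  simp

end Trivial

section Combined

variable {V : Type*} {E : Type*} [Fintype E] [DecidableEq E] [Fintype V] [DecidableEq V]
  {R : Type*} [Field R] [LinearOrder R] [IsStrictOrderedRing R]

variable (p : E → R) (ends : E → Sym2 V) {o a₁ a₂ a₃ : V} (b : V) {f : E}

omit [Fintype E] [DecidableEq E] [Fintype V] [DecidableEq V] [Field R] [LinearOrder R] [IsStrictOrderedRing R] in
/-- If `a₃` is not in the component of `o`, then `o` is not in the component of `a₃`, and neither is any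
vertex of the component of `o`. -/
lemma not_mem_blk_of_not_mem (h3 : a₃ ∉ cluster ends (sepConfig ends {a₁, a₂}) o) :
    o ∉ blk ends a₁ a₂ a₃ ∧
      ∀ x, x ∈ cluster ends (sepConfig ends {a₁, a₂}) o → x ∉ blk ends a₁ a₂ a₃ := by
  constructor
  · intro h
    exact h3 (mem_cluster.2 (conn_symm (mem_cluster.1 h)))
  · intro x hx h
    exact h3 (mem_cluster.2 (conn_trans (mem_cluster.1 hx) (conn_symm (mem_cluster.1 h))))

/-- **The `o`-class `D`-chord along `{o, a₁}` whenever `o`, `a₃`, `b` are not all in one component of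
`G − {a₁, a₂}`.** -/
theorem dChord_o_edge_of_not_same_component (hp : IsProbVec p) (hf : ends f = s(o, a₁))
    (ho : o ∉ ({a₁, a₂} : Set V)) (h3 : a₃ ∉ ({a₁, a₂} : Set V))
    (hsep : ¬ (b ∈ cluster ends (sepConfig ends {a₁, a₂}) o ∧ a₃ ∈ cluster ends (sepConfig ends {a₁, a₂}) o)) :
    NMixChord (normD ends a₁ a₂ a₃) p ends o a₁ a₂ a₃ b f := by
  by_cases hb : b ∈ cluster ends (sepConfig ends {a₁, a₂}) o
  · have h3' : a₃ ∉ cluster ends (sepConfig ends {a₁, a₂}) o := fun h => hsep ⟨hb, h⟩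
    obtain ⟨ho', hall⟩ := not_mem_blk_of_not_mem ends h3'
    exact dChord_o_edge_of_separated p ends b hp hf h3 ho' (hall b hb)
  · exact dChord_of_Gc_eq_zero p ends o a₁ a₂ a₃ b f _ (Gc_eq_zero_of_sepPair hp ends a₃ b ho hb)
      (Gc_eq_zero_of_sepPair (hp.update f le_rfl zero_le_one) ends a₃ b ho hb)
      (Gc_eq_zero_of_sepPair (hp.update f zero_le_one le_rfl) ends a₃ b ho hb)

/-- The same along `{o, a₂}`. -/
theorem dChord_o_edge₂_of_not_same_component (hp : IsProbVec p) (hf : ends f = s(o, a₂))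
    (ho : o ∉ ({a₁, a₂} : Set V)) (h3 : a₃ ∉ ({a₁, a₂} : Set V))
    (hsep : ¬ (b ∈ cluster ends (sepConfig ends {a₁, a₂}) o ∧ a₃ ∈ cluster ends (sepConfig ends {a₁, a₂}) o)) :
    NMixChord (normD ends a₁ a₂ a₃) p ends o a₁ a₂ a₃ b f := by
  by_cases hb : b ∈ cluster ends (sepConfig ends {a₁, a₂}) o
  · have h3' : a₃ ∉ cluster ends (sepConfig ends {a₁, a₂}) o := fun h => hsep ⟨hb, h⟩
    obtain ⟨ho', hall⟩ := not_mem_blk_of_not_mem ends h3'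
    exact dChord_o_edge₂_of_separated p ends b hp hf h3 ho' (hall b hb)
  · exact dChord_of_Gc_eq_zero p ends o a₁ a₂ a₃ b f _ (Gc_eq_zero_of_sepPair hp ends a₃ b ho hb)
      (Gc_eq_zero_of_sepPair (hp.update f le_rfl zero_le_one) ends a₃ b ho hb)
      (Gc_eq_zero_of_sepPair (hp.update f zero_le_one le_rfl) ends a₃ b ho hb)

/-- **(HCOV) whenever `o`, `a₃`, `b` are not all in one component of `G − {a₁, a₂}`.** -/
theorem HCov_of_not_same_component (hp : IsProbVec p) (ho : o ∉ ({a₁, a₂} : Set V))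
    (h3 : a₃ ∉ ({a₁, a₂} : Set V))
    (hsep : ¬ (b ∈ cluster ends (sepConfig ends {a₁, a₂}) o ∧ a₃ ∈ cluster ends (sepConfig ends {a₁, a₂}) o)) :
    HCov p ends o a₁ a₂ a₃ b := by
  by_cases hb : b ∈ cluster ends (sepConfig ends {a₁, a₂}) o
  · have h3' : a₃ ∉ cluster ends (sepConfig ends {a₁, a₂}) o := fun h => hsep ⟨hb, h⟩
    obtain ⟨ho', hall⟩ := not_mem_blk_of_not_mem ends h3'
    exact HCov_of_separated p ends b hp h3 ho' (hall b hb)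
  · exact HCov_of_sepPair hp ends a₃ b ho hb

/-- The chain's row along `{o, a₁}`. -/
theorem dz2Chord_o_edge_of_not_same_component (hp : IsProbVec p) (hf : ends f = s(o, a₁))
    (ho : o ∉ ({a₁, a₂} : Set V)) (h3 : a₃ ∉ ({a₁, a₂} : Set V))
    (hsep : ¬ (b ∈ cluster ends (sepConfig ends {a₁, a₂}) o ∧ a₃ ∈ cluster ends (sepConfig ends {a₁, a₂}) o)) :
    NMixChord (normDZ2 ends a₁ a₂ a₃) p ends o a₁ a₂ a₃ b f :=
  nMixChord_DZ2_of_D hp (dChord_o_edge_of_not_same_component p ends b hp hf ho h3 hsep)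
    (HCov_of_not_same_component _ ends b (hp.update f le_rfl zero_le_one) ho h3 hsep)

/-- The chain's row along `{o, a₂}`. -/
theorem dz2Chord_o_edge₂_of_not_same_component (hp : IsProbVec p) (hf : ends f = s(o, a₂))
    (ho : o ∉ ({a₁, a₂} : Set V)) (h3 : a₃ ∉ ({a₁, a₂} : Set V))
    (hsep : ¬ (b ∈ cluster ends (sepConfig ends {a₁, a₂}) o ∧ a₃ ∈ cluster ends (sepConfig ends {a₁, a₂}) o)) :
    NMixChord (normDZ2 ends a₁ a₂ a₃) p ends o a₁ a₂ a₃ b f :=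
  nMixChord_DZ2_of_D hp (dChord_o_edge₂_of_not_same_component p ends b hp hf ho h3 hsep)
    (HCov_of_not_same_component _ ends b (hp.update f le_rfl zero_le_one) ho h3 hsep)

end Combined

end Sep

end Mix

end Summit.Ventures.PercRepro2
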